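import Literature.AnabelianGeometry.AbsoluteAnabelian.UnitKummerModel
import Literature.AnabelianGeometry.AbsoluteAnabelian.MonoidKummerModelCompactProofs

/-!
# Kummer-faithfulness of the model `TCG`- and `TLG`-pairs ([AbsTopIII] Prop 3.3 (i); PROOF-ONLY)

Companion of `UnitKummerModel.lean` (S. Mochizuki, *Topics in absolute anabelian geometry III*, §3,
Prop. 3.3 (i) p. 73; bib key `MochizukiAbsTopIII2015`, lit key `paper:url-5493eb38cbb7`): the Kummer maps
`M^H → H¹(H, μ_Ẑ(M))` of the model unit Kummer theories (`unitKummerTheoryTCG`, `M = 𝒪_k̄^×`;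
`unitKummerTheoryTLG`, `M = k̄^×`) are INJECTIVE at every open `H ⊆ Π_k` with open image `ε_k(H) ⊆ G_k` — in
particular at every open `H` when `ε_k` is an open map or `Π_k` is compact.  The engine is the same as for
the `TM`-pair (`MonoidKummerModel.kummer_injective_of_isOpen`), here isolated once and for all:

* `ModelMLFGaloisData.kummerMapFixed_units_injective_of_isOpen` — the Kummer map
  `(k̄ˣ)^H → H¹(H, Λ(k̄ˣ))` on the GROUP of `H`-invariant units of `k̄` is injective (an `H`-invariant unit
  with a compatible system of `H`-invariant roots lies, with its roots, in the finite extension `k'` of `k`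
  cut out inside `ε_k(H)`, so it is `1`: `⋂ₙ (k'^×)ⁿ = 1`, `MLFClosure.eq_one_of_forall_pos_exists_pow_eq`);
* `tcgKummer_injective_of_isOpen` / `tlgKummer_injective_of_isOpen`, and the corollaries for open `ε_k`
  (`tcgKummer_injective`, `tlgKummer_injective`) and compact `Π_k` (`…_of_compactSpace`).

HONEST FRAMING: OUR kernel check of classical Kummer theory; nothing here bears on [IUTchIII] Cor. 3.12.
-/

noncomputable section

namespace Literature.AnabelianGeometry.AbsoluteAnabelian

open Literature.NumberTheory.GaloisRepresentations Literature.AnabelianGeometry.EtaleTheta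
open scoped Pointwise Topology

namespace ModelMLFGaloisData

variable (C : MLFClosure.{0}) (D : ModelMLFGaloisData C.k C.K)

/-- **The Kummer map `(k̄ˣ)^H → H¹(H, Λ(k̄ˣ))` on `H`-invariant units of `k̄` is injective** whenever the
image `ε_k(H) ⊆ G_k` is open: an invariant unit all of whose `n`-th roots can be chosen invariant lies in
the local field `k' = k̄^{ε_k(H)}`-level finite extension together with those roots, hence is `1`.
[cite: MochizukiAbsTopIII2015, Proposition 3.2 (ii) p.71] -/
theorem kummerMapFixed_units_injective_of_isOpen (H : OpenSubgroup D.Pi)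
    (hH : IsOpen (((H : Subgroup D.Pi).map D.aug : Subgroup (C.K ≃ₐ[C.k] C.K)) :
      Set (C.K ≃ₐ[C.k] C.K))) :
    Function.Injective (kummerMapFixed (A := (C.K)ˣ) (G := D.Pi) (H : Subgroup D.Pi)) := by
  refine kummerMapFixed_injective_of_iInter_pow_eq_bot _ fun a ha => ?_
  have h1 : (((H : Subgroup D.Pi).map D.aug : Subgroup (C.K ≃ₐ[C.k] C.K)) : Set (C.K ≃ₐ[C.k] C.K))
      ∈ 𝓝 (1 : C.K ≃ₐ[C.k] C.K) := hH.mem_nhds (Subgroup.one_mem _)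
  obtain ⟨E, hEfin, hEsub⟩ := (krullTopology_mem_nhds_one_iff C.k C.K _).mp h1
  haveI : FiniteDimensional C.k E := hEfin
  have hmemE : ∀ b : invariants (A := (C.K)ˣ) (H : Subgroup D.Pi), ((b : (C.K)ˣ) : C.K) ∈ E := by
    intro b
    rw [← InfiniteGalois.fixedField_fixingSubgroup E, IntermediateField.mem_fixedField_iff]
    intro σ hσ
    obtain ⟨g, hg, rfl⟩ := hEsub hσ
    have hb : g • (b : (C.K)ˣ) = b := b.2 ⟨g, hg⟩
    have hb' : D.aug g • ((b : (C.K)ˣ) : C.K) = (b : (C.K)ˣ) := by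
      rw [← D.units_coe_smul, hb]
    simpa [AlgEquiv.smul_def] using hb'
  have ha1 : ((a : (C.K)ˣ) : C.K) = 1 := by
    refine MLFClosure.eq_one_of_forall_pos_exists_pow_eq C E (hmemE a) (a : (C.K)ˣ).ne_zero
      fun n hn => ?_
    obtain ⟨b, hb⟩ := ha ⟨n, hn⟩
    refine ⟨((b : (C.K)ˣ) : C.K), hmemE b, ?_⟩
    have := congrArg (fun u : invariants (A := (C.K)ˣ) (H : Subgroup D.Pi) => ((u : (C.K)ˣ) : C.K)) hb
    simpa [Units.val_pow_eq_pow_val] using this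
  exact Subtype.ext (Units.ext ha1)

/-! ### `T = TCG`: `(Π_k ↷ 𝒪_k̄^×)` -/

/-- **The Kummer map of the model `TCG`-pair is injective** at every open `H` with open image in `G_k`.
[cite: MochizukiAbsTopIII2015, Proposition 3.3 (i) p.73] -/
theorem tcgKummer_injective_of_isOpen (H : OpenSubgroup D.tcgPair.Pi)
    (hH : IsOpen (((H : Subgroup D.Pi).map D.aug : Subgroup (C.K ≃ₐ[C.k] C.K)) :
      Set (C.K ≃ₐ[C.k] C.K))) :
    Function.Injective ((D.unitKummerTheoryTCG C).kummer H) := by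
  intro m m' hmm'
  rw [unitKummerTheoryTCG_kummer, unitKummerTheoryTCG_kummer, ← kummerMapFixed_apply,
    ← kummerMapFixed_apply] at hmm'
  have h := Additive.ofMul.injective (D.kummerMapFixed_units_injective_of_isOpen C H hH hmm')
  have h' : (tcgToUnit C m.1 : C.K) = tcgToUnit C m'.1 := by
    change ((D.tcgInvariantUnit C H m : (C.K)ˣ) : C.K) = (D.tcgInvariantUnit C H m' : (C.K)ˣ)
    rw [h]
  exact Subtype.ext (Subtype.ext h')

/-- For open `ε_k`, the Kummer map of the model `TCG`-pair is injective at every open `H`.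
[cite: MochizukiAbsTopIII2015, Proposition 3.3 (i) p.73] -/
theorem tcgKummer_injective (hε : IsOpenMap D.aug) (H : OpenSubgroup D.tcgPair.Pi) :
    Function.Injective ((D.unitKummerTheoryTCG C).kummer H) :=
  D.tcgKummer_injective_of_isOpen C H (by
    rw [Subgroup.coe_map]
    exact hε _ H.isOpen)

/-- For compact `Π_k`, the Kummer map of the model `TCG`-pair is injective at every open `H`.
[cite: MochizukiAbsTopIII2015, Proposition 3.3 (i) p.73] -/
theorem tcgKummer_injective_of_compactSpace [CompactSpace D.Pi] (H : OpenSubgroup D.tcgPair.Pi) :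
    Function.Injective ((D.unitKummerTheoryTCG C).kummer H) :=
  D.tcgKummer_injective C D.isOpenMap_aug_of_compactSpace H

/-! ### `T = TLG`: `(Π_k ↷ k̄^×)` -/

/-- **The Kummer map of the model `TLG`-pair is injective** at every open `H` with open image in `G_k`.
[cite: MochizukiAbsTopIII2015, Proposition 3.3 (i) p.73] -/
theorem tlgKummer_injective_of_isOpen (H : OpenSubgroup D.tlgPair.Pi)
    (hH : IsOpen (((H : Subgroup D.Pi).map D.aug : Subgroup (C.K ≃ₐ[C.k] C.K)) :
      Set (C.K ≃ₐ[C.k] C.K))) :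
    Function.Injective ((D.unitKummerTheoryTLG C).kummer H) := by
  intro m m' hmm'
  rw [unitKummerTheoryTLG_kummer, unitKummerTheoryTLG_kummer, ← kummerMapFixed_apply,
    ← kummerMapFixed_apply] at hmm'
  have h := Additive.ofMul.injective (D.kummerMapFixed_units_injective_of_isOpen C H hH hmm')
  have h' : (tlgToUnit C m.1 : C.K) = tlgToUnit C m'.1 := by
    change ((D.tlgInvariantUnit C H m : (C.K)ˣ) : C.K) = (D.tlgInvariantUnit C H m' : (C.K)ˣ)
    rw [h]
  exact Subtype.ext (Subtype.ext h')

/-- For open `ε_k`, the Kummer map of the model `TLG`-pair is injective at every open `H`.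
[cite: MochizukiAbsTopIII2015, Proposition 3.3 (i) p.73] -/
theorem tlgKummer_injective (hε : IsOpenMap D.aug) (H : OpenSubgroup D.tlgPair.Pi) :
    Function.Injective ((D.unitKummerTheoryTLG C).kummer H) :=
  D.tlgKummer_injective_of_isOpen C H (by
    rw [Subgroup.coe_map]
    exact hε _ H.isOpen)

/-- For compact `Π_k`, the Kummer map of the model `TLG`-pair is injective at every open `H`.
[cite: MochizukiAbsTopIII2015, Proposition 3.3 (i) p.73] -/
theorem tlgKummer_injective_of_compactSpace [CompactSpace D.Pi] (H : OpenSubgroup D.tlgPair.Pi) :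
    Function.Injective ((D.unitKummerTheoryTLG C).kummer H) :=
  D.tlgKummer_injective C D.isOpenMap_aug_of_compactSpace H

end ModelMLFGaloisData

end Literature.AnabelianGeometry.AbsoluteAnabelian

end
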